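import Summits.NavierStokesRegularity.TurbBounds.SpectralFormFreeSlip
import Summits.NavierStokesRegularity.TurbBounds.FSU1.Mode.M01Calculus
import Summits.NavierStokesRegularity.TurbBounds.FSU1.Mode.M02Poincare
import Summits.NavierStokesRegularity.TurbBounds.FSU1.Mode.M04Young

/-!
# FS-U1″ mode lemma — RegimeI (`TurbBounds/FSU1/Mode/M05RegimeI.lean`)

FS-PROOF-DRAFT §3.3, LEMMA I (regime I): `E_u ≥ 0` under the explicit layer condition.

Cell-made mathematics of FS-PROOF-DRAFT §3 (pub-turb-sos), kernel-checked; generated from the design compose file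
`StageF_compose.check.lean` (96c4b9bf…) by `build_mode_split.py`.  HONEST FRAMING: rigorous bounds for the stated PDE and boundary conditions; no claim about physical turbulence beyond the bound.
-/

open Real intervalIntegral MeasureTheory Set

namespace Summit.NavierStokesRegularity.TurbBounds.FSU1.Mode

open Summit.NavierStokesRegularity.TurbBounds.SpectralFormFreeSlip

/-- Quarter-wave Poincaré at the RIGHT wall: `f 1 = 0` ⇒ `(π/(2δ))² ∫_{1−δ}^1 f² ≤ ∫_{1−δ}^1 f′²`. -/
theorem quarter_wave_poincare_right {f f' : ℝ → ℝ} (hf : ∀ x, HasDerivAt f (f' x) x) (hf' : Continuous f')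
    (h1 : f 1 = 0) {δ : ℝ} (hδ : 0 < δ) :
    (π / (2 * δ)) ^ 2 * ∫ z in (1 - δ)..1, f z ^ 2 ≤ ∫ z in (1 - δ)..1, f' z ^ 2 := by
  have hg : ∀ x, HasDerivAt (fun x => f (1 - x)) (-f' (1 - x)) x := fun x =>
    HasDerivAt.comp_const_sub 1 x (hf (1 - x))
  have hg' : Continuous fun x => -f' (1 - x) := (hf'.comp (continuous_const.sub continuous_id)).neg
  have h0 : (fun x => f (1 - x)) 0 = 0 := by simp [h1]
  have P := quarter_wave_poincare hg hg' h0 hδ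
  have e1 : ∫ z in (0:ℝ)..δ, f (1 - z) ^ 2 = ∫ z in (1 - δ)..1, f z ^ 2 := by
    have := intervalIntegral.integral_comp_sub_left (fun z => f z ^ 2) (1:ℝ) (a := 0) (b := δ)
    simpa using this
  have e2 : ∫ z in (0:ℝ)..δ, (-f' (1 - z)) ^ 2 = ∫ z in (1 - δ)..1, f' z ^ 2 := by
    have := intervalIntegral.integral_comp_sub_left (fun z => f' z ^ 2) (1:ℝ) (a := 0) (b := δ)
    simp only [neg_sq]
    simpa using this
  have P' : (π / (2 * δ)) ^ 2 * ∫ z in (0:ℝ)..δ, f (1 - z) ^ 2 ≤ ∫ z in (0:ℝ)..δ, (-f' (1 - z)) ^ 2 := by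
    simpa using P
  rw [e1, e2] at P'
  exact P'

/-- Outer layers carry at most the whole integral of a non-negative continuous function. -/
theorem layers_le_whole {h : ℝ → ℝ} (hc : Continuous h) (hnn : ∀ z, 0 ≤ h z) {δ : ℝ} (_hδ : 0 < δ) (hδ2 : δ ≤ 1 / 2) :
    (∫ z in (0:ℝ)..δ, h z) + ∫ z in (1 - δ)..1, h z ≤ ∫ z in (0:ℝ)..1, h z := by
  have i1 := hc.intervalIntegrable (μ := volume) 0 δ
  have i2 := hc.intervalIntegrable (μ := volume) δ (1 - δ)
  have i3 := hc.intervalIntegrable (μ := volume) (1 - δ) 1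
  have S12 := intervalIntegral.integral_add_adjacent_intervals i1 i2
  have S123 := intervalIntegral.integral_add_adjacent_intervals (i1.trans i2) i3
  have hmid : 0 ≤ ∫ z in δ..(1 - δ), h z := intervalIntegral.integral_nonneg (by linarith) fun z _ => hnn z
  linarith

/-- Pointwise Young on a layer: `−(1/δ)∫ vθ ≥ −(A∫θ² + (1/(4Aδ²))∫v²)`. -/
theorem layer_young {v θ : ℝ → ℝ} (hv : Continuous v) (hθ : Continuous θ) {A δ lo hi : ℝ} (hA : 0 < A) (hδ : 0 < δ) (hlh : lo ≤ hi) :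
    -(A * (∫ z in lo..hi, θ z ^ 2) + 1 / (4 * A * δ ^ 2) * ∫ z in lo..hi, v z ^ 2) ≤ -(1 / δ) * ∫ z in lo..hi, v z * θ z := by
  have h4 : 0 < 4 * A * δ ^ 2 := by positivity
  have key : 0 ≤ ∫ z in lo..hi, (A * θ z ^ 2 + 1 / (4 * A * δ ^ 2) * v z ^ 2 - 1 / δ * (v z * θ z)) := by
    refine intervalIntegral.integral_nonneg hlh fun z _ => ?_
    have e : A * θ z ^ 2 + 1 / (4 * A * δ ^ 2) * v z ^ 2 - 1 / δ * (v z * θ z)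
        = (2 * A * δ * θ z - v z) ^ 2 / (4 * A * δ ^ 2) := by
      field_simp
      ring
    rw [e]; positivity
  have i1 : IntervalIntegrable (fun z => A * θ z ^ 2) volume lo hi :=
    show IntervalIntegrable (fun z => A * θ z ^ 2) volume lo hi from ((hθ.pow 2).const_mul A).intervalIntegrable _ _
  have i2 : IntervalIntegrable (fun z => 1 / (4 * A * δ ^ 2) * v z ^ 2) volume lo hi :=
    show IntervalIntegrable (fun z => 1 / (4 * A * δ ^ 2) * v z ^ 2) volume lo hi from ((hv.pow 2).const_mul _).intervalIntegrable _ _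
  have i3 : IntervalIntegrable (fun z => 1 / δ * (v z * θ z)) volume lo hi :=
    show IntervalIntegrable (fun z => 1 / δ * (v z * θ z)) volume lo hi from ((hv.mul hθ).const_mul _).intervalIntegrable _ _
  rw [intervalIntegral.integral_sub (i1.add i2) i3, intervalIntegral.integral_add i1 i2] at key
  simp only [intervalIntegral.integral_const_mul] at key
  linarith

/-- The profile term of the two-layer profile: `∫₀¹ 2τ′vθ = −(1/δ)∫₀^δ vθ − (1/δ)∫_{1−δ}^1 vθ`, with integrability. -/
theorem two_layer_term {τp v θ : ℝ → ℝ} (hv : Continuous v) (hθ : Continuous θ) {δ : ℝ} (hδ : 0 < δ) (hδ2 : δ ≤ 1 / 2)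
    (hL : EqOn τp (fun _ => -(1 / (2 * δ))) (Ioo 0 δ)) (hM : EqOn τp (fun _ => 0) (Ioo δ (1 - δ)))
    (hR : EqOn τp (fun _ => -(1 / (2 * δ))) (Ioo (1 - δ) 1)) :
    IntervalIntegrable (fun z => 2 * τp z * v z * θ z) volume 0 1 ∧
      ∫ z in (0:ℝ)..1, 2 * τp z * v z * θ z = -(1 / δ) * (∫ z in (0:ℝ)..δ, v z * θ z) + -(1 / δ) * ∫ z in (1 - δ)..1, v z * θ z := by
  have hδ1 : δ ≤ 1 - δ := by linarith
  have hδ3 : 1 - δ ≤ 1 := by linarith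
  have hcont : Continuous fun z => -(1 / δ) * (v z * θ z) := continuous_const.mul (hv.mul hθ)
  have eL : EqOn (fun z => 2 * τp z * v z * θ z) (fun z => -(1 / δ) * (v z * θ z)) (Ioo 0 δ) := fun z hz => by
    simp only [hL hz]; ring
  have eM : EqOn (fun z => 2 * τp z * v z * θ z) (fun _ => (0:ℝ)) (Ioo δ (1 - δ)) := fun z hz => by
    simp only [hM hz]; ring
  have eR : EqOn (fun z => 2 * τp z * v z * θ z) (fun z => -(1 / δ) * (v z * θ z)) (Ioo (1 - δ) 1) := fun z hz => by
    simp only [hR hz]; ring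
  have I1 : IntervalIntegrable (fun z => 2 * τp z * v z * θ z) volume 0 δ :=
    (hcont.intervalIntegrable 0 δ).congr_uIoo (by rw [uIoo_of_le hδ.le]; exact eL.symm)
  have I2 : IntervalIntegrable (fun z => 2 * τp z * v z * θ z) volume δ (1 - δ) :=
    (intervalIntegrable_const (c := (0:ℝ))).congr_uIoo (by rw [uIoo_of_le hδ1]; exact eM.symm)
  have I3 : IntervalIntegrable (fun z => 2 * τp z * v z * θ z) volume (1 - δ) 1 :=
    (hcont.intervalIntegrable (1 - δ) 1).congr_uIoo (by rw [uIoo_of_le hδ3]; exact eR.symm)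
  have V1 : ∫ z in (0:ℝ)..δ, 2 * τp z * v z * θ z = -(1 / δ) * ∫ z in (0:ℝ)..δ, v z * θ z := by
    rw [intervalIntegral.integral_congr_Ioo_of_le hδ.le eL, intervalIntegral.integral_const_mul]
  have V2 : ∫ z in δ..(1 - δ), 2 * τp z * v z * θ z = 0 := by
    rw [intervalIntegral.integral_congr_Ioo_of_le hδ1 eM]; simp
  have V3 : ∫ z in (1 - δ)..(1:ℝ), 2 * τp z * v z * θ z = -(1 / δ) * ∫ z in (1 - δ)..1, v z * θ z := by
    rw [intervalIntegral.integral_congr_Ioo_of_le hδ3 eR, intervalIntegral.integral_const_mul]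
  have S12 := intervalIntegral.integral_add_adjacent_intervals I1 I2
  have S123 := intervalIntegral.integral_add_adjacent_intervals (I1.trans I2) I3
  refine ⟨(I1.trans I2).trans I3, ?_⟩
  rw [← S123, ← S12, V1, V2, V3]; ring

/-- The free-slip vorticity identity (only `v(0) = v(1) = 0` is used): `k²∫₀¹Ω² = ∫v″² + 2k²∫v′² + k⁴∫v²`. -/
theorem vort_sq_identity {v : ℝ → ℝ} (hv : ContDiff ℝ 3 v) (h0 : v 0 = 0) (h1 : v 1 = 0) {k : ℝ} (hk : k ≠ 0) :
    k ^ 2 * ∫ z in (0:ℝ)..1, vort k v z ^ 2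
      = (∫ z in (0:ℝ)..1, deriv (deriv v) z ^ 2) + 2 * k ^ 2 * (∫ z in (0:ℝ)..1, deriv v z ^ 2)
        + k ^ 4 * ∫ z in (0:ℝ)..1, v z ^ 2 := by
  have hvc : Continuous v := hv.continuous
  have hv1 : ContDiff ℝ 1 v := hv.of_le (by norm_num)
  have hv' : Continuous (deriv v) := hv1.continuous_deriv le_rfl
  have hv'' : Continuous (deriv (deriv v)) := (contDiff_one_deriv_deriv hv).continuous
  have hdv : ∀ x, HasDerivAt v (deriv v x) x := fun x => (hv1.differentiable one_ne_zero x).hasDerivAt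
  have hdv' : ∀ x, HasDerivAt (deriv v) (deriv (deriv v) x) x := fun x =>
    ((contDiff_two_deriv hv).differentiable (by norm_num) x).hasDerivAt
  -- integration by parts: ∫ v v″ = −∫ v′²
  have IBP := intervalIntegral.integral_mul_deriv_eq_deriv_mul (a := (0:ℝ)) (b := 1)
    (fun x _ => hdv x) (fun x _ => hdv' x) (hv'.intervalIntegrable 0 1) (hv''.intervalIntegrable 0 1)
  rw [h0, h1] at IBP
  simp only [zero_mul, sub_zero] at IBP
  -- pointwise expansion of k²Ω²
  have e : (fun z => k ^ 2 * vort k v z ^ 2)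
      = fun z => deriv (deriv v) z ^ 2 - 2 * k ^ 2 * (v z * deriv (deriv v) z) + k ^ 4 * v z ^ 2 := by
    funext z; simp only [vort]; field_simp; ring
  have i1 : IntervalIntegrable (fun z => deriv (deriv v) z ^ 2) volume 0 1 := (hv''.pow 2).intervalIntegrable 0 1
  have i2 : IntervalIntegrable (fun z => 2 * k ^ 2 * (v z * deriv (deriv v) z)) volume 0 1 :=
    ((hvc.mul hv'').const_mul _).intervalIntegrable 0 1
  have i3 : IntervalIntegrable (fun z => k ^ 4 * v z ^ 2) volume 0 1 := ((hvc.pow 2).const_mul _).intervalIntegrable 0 1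
  rw [← intervalIntegral.integral_const_mul, e, intervalIntegral.integral_add (i1.sub i2) i3,
    intervalIntegral.integral_sub i1 i2, intervalIntegral.integral_const_mul, intervalIntegral.integral_const_mul, IBP]
  have e2 : ∫ z in (0:ℝ)..1, deriv v z * deriv v z = ∫ z in (0:ℝ)..1, deriv v z ^ 2 :=
    intervalIntegral.integral_congr fun z _ => by ring
  rw [e2]; ring

/-- **LEMMA I (regime I), FS-PROOF-DRAFT §3.3.** -/
theorem lemmaI {Ra a b u k δ : ℝ} {τp v θ : ℝ → ℝ} (hp : FreeSlipPair v θ)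
    (hRa : 0 < Ra) (ha : 0 < a) (hk : 0 < k) (_hu0 : 0 < u) (hu1 : u ≤ 1) (hbu : 0 ≤ b - a ^ 2 / (4 * u))
    (hδ : 0 < δ) (hδ2 : δ ≤ 1 / 2)
    (hL : EqOn τp (fun _ => -(1 / (2 * δ))) (Ioo 0 δ)) (hM : EqOn τp (fun _ => 0) (Ioo δ (1 - δ)))
    (hR : EqOn τp (fun _ => -(1 / (2 * δ))) (Ioo (1 - δ) 1))
    (hI : 1 / (4 * (π ^ 2 / (4 * δ ^ 2) + (1 - u) * k ^ 2) * δ ^ 2 * (k ^ 2 + π ^ 2 / (2 * δ ^ 2)))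
            ≤ a / (Ra * Real.sqrt Ra) * k ^ 2) :
    0 ≤ Eu u Ra a b τp k v θ := by
  -- regularity
  have hθc : Continuous θ := hp.hθ.continuous
  have hθ' : Continuous (deriv θ) := continuous_deriv_of_contDiff_one hp.hθ
  have hvc : Continuous v := hp.hv.continuous
  have hv1 : ContDiff ℝ 1 v := hp.hv.of_le (by norm_num)
  have hv' : Continuous (deriv v) := hv1.continuous_deriv le_rfl
  have hv'' : Continuous (deriv (deriv v)) := (contDiff_one_deriv_deriv hp.hv).continuous
  have hΩ : Continuous (vort k v) := continuous_vort hp.hv k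
  have hΩ' : Continuous (deriv (vort k v)) := continuous_deriv_vort hp.hv k
  have hdθ : ∀ x, HasDerivAt θ (deriv θ x) x := fun x => (hp.hθ.differentiable one_ne_zero x).hasDerivAt
  have hdv : ∀ x, HasDerivAt v (deriv v x) x := fun x => (hv1.differentiable one_ne_zero x).hasDerivAt
  -- constants
  set α : ℝ := a / (Ra * Real.sqrt Ra) with hαdef
  have hα : 0 < α := by positivity
  set c2 : ℝ := π ^ 2 / (4 * δ ^ 2) with hc2def
  have hc2 : 0 < c2 := by positivity
  have hc2e : (π / (2 * δ)) ^ 2 = c2 := by rw [hc2def]; field_simp; ring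
  set A : ℝ := c2 + (1 - u) * k ^ 2 with hAdef
  have h1u : 0 ≤ (1 - u) * k ^ 2 := mul_nonneg (by linarith) (sq_nonneg k)
  have hA : 0 < A := by rw [hAdef]; linarith
  have hbu' : 0 ≤ (b - a ^ 2 / (4 * u)) / Ra := div_nonneg hbu hRa.le
  -- the profile term
  obtain ⟨hHint, hHval⟩ := two_layer_term hvc hθc hδ hδ2 hL hM hR
  -- Eu = ∫ G + ∫ H
  set G : ℝ → ℝ := fun z => deriv θ z ^ 2 + (1 - u) * k ^ 2 * θ z ^ 2
      + α * (deriv (vort k v) z ^ 2 + k ^ 2 * vort k v z ^ 2) + (b - a ^ 2 / (4 * u)) / Ra * vort k v z ^ 2 with hGdef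
  have hGc : Continuous G := by
    rw [hGdef]
    exact (((hθ'.pow 2).add (continuous_const.mul (hθc.pow 2))).add
      (continuous_const.mul ((hΩ'.pow 2).add (continuous_const.mul (hΩ.pow 2))))).add (continuous_const.mul (hΩ.pow 2))
  have hFG : (fun z => fsIntegrand Ra a b τp k v θ z - youngDensity u Ra a k v θ z)
      = fun z => G z + 2 * τp z * v z * θ z := by
    funext z
    simp only [fsIntegrand, youngDensity, hGdef, hαdef]
    ring
  have hEu : Eu u Ra a b τp k v θ = (∫ z in (0:ℝ)..1, G z) + ∫ z in (0:ℝ)..1, 2 * τp z * v z * θ z := by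
    unfold Eu; rw [hFG, intervalIntegral.integral_add (hGc.intervalIntegrable (μ := volume) 0 1) hHint]
  -- ∫ G in named pieces
  have iθp : IntervalIntegrable (fun z => deriv θ z ^ 2) volume 0 1 := (hθ'.pow 2).intervalIntegrable (μ := volume) 0 1
  have iθ : IntervalIntegrable (fun z => (1 - u) * k ^ 2 * θ z ^ 2) volume 0 1 :=
    ((hθc.pow 2).const_mul ((1 - u) * k ^ 2)).intervalIntegrable (μ := volume) 0 1
  have iΩp : IntervalIntegrable (fun z => deriv (vort k v) z ^ 2) volume 0 1 := (hΩ'.pow 2).intervalIntegrable (μ := volume) 0 1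
  have iΩk : IntervalIntegrable (fun z => k ^ 2 * vort k v z ^ 2) volume 0 1 := ((hΩ.pow 2).const_mul _).intervalIntegrable (μ := volume) 0 1
  have iα : IntervalIntegrable (fun z => α * (deriv (vort k v) z ^ 2 + k ^ 2 * vort k v z ^ 2)) volume 0 1 := (iΩp.add iΩk).const_mul α
  have ib : IntervalIntegrable (fun z => (b - a ^ 2 / (4 * u)) / Ra * vort k v z ^ 2) volume 0 1 :=
    ((hΩ.pow 2).const_mul _).intervalIntegrable (μ := volume) 0 1
  have hGval : ∫ z in (0:ℝ)..1, G z = (∫ z in (0:ℝ)..1, deriv θ z ^ 2) + (1 - u) * k ^ 2 * (∫ z in (0:ℝ)..1, θ z ^ 2)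
      + α * ((∫ z in (0:ℝ)..1, deriv (vort k v) z ^ 2) + k ^ 2 * ∫ z in (0:ℝ)..1, vort k v z ^ 2)
      + (b - a ^ 2 / (4 * u)) / Ra * ∫ z in (0:ℝ)..1, vort k v z ^ 2 := by
    simp only [hGdef]
    rw [intervalIntegral.integral_add ((iθp.add iθ).add iα) ib, intervalIntegral.integral_add (iθp.add iθ) iα,
      intervalIntegral.integral_add iθp iθ]
    simp only [intervalIntegral.integral_const_mul]
    rw [intervalIntegral.integral_add iΩp iΩk]
    simp only [intervalIntegral.integral_const_mul]
  -- Poincaré on the four layer pieces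
  have Pθ := quarter_wave_poincare hdθ hθ' hp.θ_bot hδ
  have PθR := quarter_wave_poincare_right hdθ hθ' hp.θ_top hδ
  have Pv := quarter_wave_poincare hdv hv' hp.v_bot hδ
  have PvR := quarter_wave_poincare_right hdv hv' hp.v_top hδ
  rw [hc2e] at Pθ PθR Pv PvR
  -- layers ≤ whole
  have Fθp := layers_le_whole (h := fun z => deriv θ z ^ 2) (hθ'.pow 2) (fun z => sq_nonneg _) hδ hδ2
  have Fθ := layers_le_whole (h := fun z => θ z ^ 2) (hθc.pow 2) (fun z => sq_nonneg _) hδ hδ2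
  have Fvp := layers_le_whole (h := fun z => deriv v z ^ 2) (hv'.pow 2) (fun z => sq_nonneg _) hδ hδ2
  have Fv := layers_le_whole (h := fun z => v z ^ 2) (hvc.pow 2) (fun z => sq_nonneg _) hδ hδ2
  beta_reduce at Fθp Fθ Fvp Fv
  -- Young on the two layers
  have YL := layer_young hvc hθc hA hδ hδ.le (lo := 0) (hi := δ)
  have YR := layer_young hvc hθc hA hδ (show 1 - δ ≤ 1 by linarith)
  -- vorticity identity and non-negativity of the dropped pieces
  have VI := vort_sq_identity hp.hv hp.v_bot hp.v_top hk.ne'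
  have hvpp : 0 ≤ ∫ z in (0:ℝ)..1, deriv (deriv v) z ^ 2 := intervalIntegral.integral_nonneg zero_le_one fun z _ => sq_nonneg _
  have hΩp0 : 0 ≤ ∫ z in (0:ℝ)..1, deriv (vort k v) z ^ 2 := intervalIntegral.integral_nonneg zero_le_one fun z _ => sq_nonneg _
  have hΩ0 : 0 ≤ ∫ z in (0:ℝ)..1, vort k v z ^ 2 := intervalIntegral.integral_nonneg zero_le_one fun z _ => sq_nonneg _
  have hθL0 : 0 ≤ ∫ z in (0:ℝ)..δ, θ z ^ 2 := intervalIntegral.integral_nonneg hδ.le fun z _ => sq_nonneg _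
  have hθR0 : 0 ≤ ∫ z in (1 - δ)..1, θ z ^ 2 := intervalIntegral.integral_nonneg (by linarith) fun z _ => sq_nonneg _
  have hvL0 : 0 ≤ ∫ z in (0:ℝ)..δ, v z ^ 2 := intervalIntegral.integral_nonneg hδ.le fun z _ => sq_nonneg _
  have hvR0 : 0 ≤ ∫ z in (1 - δ)..1, v z ^ 2 := intervalIntegral.integral_nonneg (by linarith) fun z _ => sq_nonneg _
  -- name the atoms
  set IΩ := ∫ z in (0:ℝ)..1, vort k v z ^ 2
  set IvL := ∫ z in (0:ℝ)..δ, v z ^ 2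
  set IvR := ∫ z in (1 - δ)..1, v z ^ 2
  set Iv := ∫ z in (0:ℝ)..1, v z ^ 2
  set Ivp := ∫ z in (0:ℝ)..1, deriv v z ^ 2
  set IvpL := ∫ z in (0:ℝ)..δ, deriv v z ^ 2
  set IvpR := ∫ z in (1 - δ)..1, deriv v z ^ 2
  -- T2: (IvL + IvR) ≤ IΩ / (k² + 2 c2)
  have hk2 : 0 < k ^ 2 := by positivity
  have T2a : k ^ 2 * ((k ^ 2 + 2 * c2) * (IvL + IvR)) ≤ k ^ 2 * IΩ := by
    have h1 : k ^ 2 * (IvL + IvR) ≤ k ^ 2 * Iv := mul_le_mul_of_nonneg_left Fv hk2.le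
    have h2 : (k ^ 2 + 2 * c2) * (IvL + IvR) ≤ 2 * Ivp + k ^ 2 * Iv := by linarith [Pv, PvR, Fvp, h1]
    have h3 := mul_le_mul_of_nonneg_left h2 hk2.le
    linarith [VI, hvpp, h3]
  have T2b : (k ^ 2 + 2 * c2) * (IvL + IvR) ≤ IΩ := le_of_mul_le_mul_left T2a hk2
  have T2c : IvL + IvR ≤ IΩ / (k ^ 2 + 2 * c2) := by
    rw [le_div_iff₀ (by positivity)]; linarith
  have T2d : 1 / (4 * A * δ ^ 2) * (IvL + IvR) ≤ α * k ^ 2 * IΩ := by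
    have h2c : 2 * c2 = π ^ 2 / (2 * δ ^ 2) := by rw [hc2def]; field_simp; ring
    have hI' : 1 / (4 * A * δ ^ 2 * (k ^ 2 + 2 * c2)) ≤ α * k ^ 2 := by rw [h2c]; exact hI
    calc 1 / (4 * A * δ ^ 2) * (IvL + IvR) ≤ 1 / (4 * A * δ ^ 2) * (IΩ / (k ^ 2 + 2 * c2)) :=
          mul_le_mul_of_nonneg_left T2c (by positivity)
      _ = 1 / (4 * A * δ ^ 2 * (k ^ 2 + 2 * c2)) * IΩ := by
          rw [div_eq_mul_one_div IΩ (k ^ 2 + 2 * c2), mul_left_comm, one_div_mul_one_div, mul_comm]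
      _ ≤ α * k ^ 2 * IΩ := mul_le_mul_of_nonneg_right hI' hΩ0
  -- T1: θ part
  have T1 : A * ((∫ z in (0:ℝ)..δ, θ z ^ 2) + ∫ z in (1 - δ)..1, θ z ^ 2)
      ≤ (∫ z in (0:ℝ)..1, deriv θ z ^ 2) + (1 - u) * k ^ 2 * ∫ z in (0:ℝ)..1, θ z ^ 2 := by
    have := mul_le_mul_of_nonneg_left Fθ h1u
    rw [hAdef]
    linarith [Pθ, PθR, Fθp, this]
  -- assemble
  rw [hEu, hGval, hHval]
  linarith [T1, T2d, YL, YR, mul_nonneg hα.le hΩp0, mul_nonneg hbu' hΩ0]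

/-- Regime I for the sign-free tree functional. -/
theorem fsModeForm_nonneg_regimeI {Ra a b u k δ : ℝ} {τp v θ : ℝ → ℝ} (hp : FreeSlipPair v θ)
    (hRa : 0 < Ra) (ha : 0 < a) (hk : 0 < k) (hu0 : 0 < u) (hu1 : u ≤ 1) (hbu : 0 ≤ b - a ^ 2 / (4 * u))
    (hδ : 0 < δ) (hδ2 : δ ≤ 1 / 2)
    (hL : EqOn τp (fun _ => -(1 / (2 * δ))) (Ioo 0 δ)) (hM : EqOn τp (fun _ => 0) (Ioo δ (1 - δ)))
    (hR : EqOn τp (fun _ => -(1 / (2 * δ))) (Ioo (1 - δ) 1))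
    (hI : 1 / (4 * (π ^ 2 / (4 * δ ^ 2) + (1 - u) * k ^ 2) * δ ^ 2 * (k ^ 2 + π ^ 2 / (2 * δ ^ 2)))
            ≤ a / (Ra * Real.sqrt Ra) * k ^ 2) :
    0 ≤ fsModeForm Ra a b τp k v θ := by
  have hθc : Continuous θ := hp.hθ.continuous
  have hvc : Continuous v := hp.hv.continuous
  have hθ' : Continuous (deriv θ) := continuous_deriv_of_contDiff_one hp.hθ
  have hΩ : Continuous (vort k v) := continuous_vort hp.hv k
  have hΩ' : Continuous (deriv (vort k v)) := continuous_deriv_vort hp.hv k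
  obtain ⟨hHint, -⟩ := two_layer_term hvc hθc hδ hδ2 hL hM hR
  have hI' : IntervalIntegrable (fsIntegrand Ra a b τp k v θ) volume 0 1 := by
    have e : fsIntegrand Ra a b τp k v θ = fun z => (deriv θ z ^ 2 + k ^ 2 * θ z ^ 2
        + a / (Ra * Real.sqrt Ra) * (deriv (vort k v) z ^ 2 + k ^ 2 * vort k v z ^ 2) + b / Ra * vort k v z ^ 2)
        + 2 * τp z * v z * θ z := by
      funext z; unfold fsIntegrand; ring
    rw [e]
    refine IntervalIntegrable.add ?_ hHint
    exact ((((hθ'.pow 2).add (continuous_const.mul (hθc.pow 2))).add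
      (continuous_const.mul ((hΩ'.pow 2).add (continuous_const.mul (hΩ.pow 2))))).add
      (continuous_const.mul (hΩ.pow 2))).intervalIntegrable 0 1
  exact (lemmaI hp hRa ha hk hu0 hu1 hbu hδ hδ2 hL hM hR hI).trans (Eu_le_fsModeForm hp hu0 hRa hk.le ha.le hI')

end Summit.NavierStokesRegularity.TurbBounds.FSU1.Mode
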